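import Literature.ModelTheory.PseudofiniteFields.DefinableSetsFiniteFields
import Mathlib.Algebra.Group.AddChar
import Mathlib.Algebra.MvPolynomial.CommRing
import HarnessLib

/-!
# Exponential sums over definable subsets of finite fields (Kowalski 2007, Theorem 14)

E. Kowalski, *Exponential sums over definable subsets of finite fields*, Israel J. Math. **160**
(2007) 219–251 (bib `Kowalski2007`; held text `paper:arxiv-math_0504316` = arXiv:math/0504316),
§3 and §6. Setting (§3, p. 6): a first-order formula `φ(x, y)` of the language of rings with
variables `x = (x₁, …, x_n)` and parameters `y = (y₁, …, y_m)`; `φ(A, y) = {x ∈ Aⁿ | A ⊨ φ(x, y)}`;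
for finite fields `𝔽_q` an additive character `ψ` and a multiplicative character `χ` of `𝔽_q`;
INTEGER polynomials `f₁, f₂, g₁, g₂ ∈ ℤ[X₁, …, X_n]`, `f = f₁/f₂`, `g = g₁/g₂`; the sums
`S(y, φ, 𝔽_q) = ∑_{x ∈ φ(𝔽_q, y)} ψ(f(x)) χ(g(x))` ((3.2)).

**Theorem 14** (p. 15). (1) There is `B₂ ≥ 0` (depending only on `φ` and the degrees) such that
for all `q` large enough and all `y ∈ 𝔽_q^m`, `S(y, φ, 𝔽_q)` is a signed combination
`∑_κ ∑_i ((-1)^{i+1}/i!) ∑_{j ≤ β} ε(α_{κ,i,j}(y)) α_{κ,i,j}(y)` of `≤ K e B₂` signed `q`-Weil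
numbers of (integer) weights `w(α) ≤ 2δ(y)`, hence `|S(y, φ, 𝔽_q)| ≤ 3 K B₂ q^{δ(y) − γ(y)/2}`,
`γ(y) = 2δ(y) − max w ≥ 0`. (2) There is `η > 0` depending only on `φ` such that for `p` large
enough (depending only on `φ` and `deg f₁, deg f₂`), `γ(y) > 0` unless `ψ` is trivial or some
`c ∈ 𝔽_q` has `|{x ∈ φ(𝔽_q, y) : f(x) = c}| ≥ η |φ(𝔽_q, y)|`. Here `δ(y)` is the "dimension" of
**Theorem 12 / Corollary 13** (Chatzidakis–van den Dries–Macintyre): `| |φ(𝔽_q, y)| − μ(y) q^{δ(y)} |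
≤ C q^{δ(y) − 1/2}` for all `𝔽_q`, with `μ(y) ∈ ℚ_{>0}` unless `φ(𝔽_q, y) = ∅` and only finitely
many pairs `(δ(y), μ(y))` (the tree's `ChatzidakisVanDenDriesMacintyre1992_mainTheorem`,
`DefinableSetsFiniteFields.lean`). **Remark 15** (1): `p` (not only `q`) large is necessary
(Artin–Schreier: `ψ(xᵖ − x) = 1`). **Theorem 2** (p. 6) is the same dichotomy over the prime
fields `𝔽_p`, all `p`, in the RELATIVE shape `|S| ≤ C p^{−1/2} |φ(𝔽_p, y)|` ("just a rephrasing
of" Cor. 16, p. 16).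

## What is vendored, and in which form

The named fact `Kowalski2007_thm14` below is Theorem 14 (1)+(2) in the special case of PURE
ADDITIVE sums of a POLYNOMIAL phase (`g = 1`, `χ = 1` — Kowalski's convention `χ(0) = 1` for the
trivial `χ` makes the factor `χ(g(x))` identically `1` —, `f₂ = 1`, `f = f₁ ∈ ℤ[X]`), for all
finite fields of characteristic `≥ p₀`, in the `q`-Weil-number-free RELATIVE shape of Theorem 2:

  `(∃ c, |{x ∈ φ(F, y) : f(x) = c}| ≥ η |φ(F, y)|) ∨ |∑_{x ∈ φ(F, y)} ψ(f(x))| ≤ C |F|^{−1/2} |φ(F, y)|`.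

Derivation from the printed statements (Kowalski's own proof of Thm. 2 / Cor. 16, for `𝔽_q` in
place of `𝔽_p`): take `p₀ ≥` the `q₀` of (1) and the `p₀` of (2) (note `q ≥ p`). If `φ(F, y) = ∅`
the sum is `0`. Otherwise, if no level set is large and `ψ ≠ 1`, (2) gives `γ(y) > 0`, i.e.
`γ(y) ≥ 1` (weights are integers, p. 12), so `|S| ≤ 3 K B₂ q^{δ(y) − 1/2}` by (1); by Cor. 13,
`|φ(F, y)| ≥ μ(y) q^{δ(y)} − C₁₃ q^{δ(y) − 1/2} ≥ (μ(y)/2) q^{δ(y)}` once `q ≥ (2 C₁₃/μ_min)²`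
(`μ_min > 0` the least of the finitely many `μ(y)`), whence `|S| ≤ (6 K B₂/μ_min) q^{−1/2} |φ(F, y)|`;
and for the finitely many smaller `q` the trivial bound `|S| ≤ |φ(F, y)| ≤ (2C₁₃/μ_min) q^{−1/2}
|φ(F, y)|` serves. Conversely the printed exponent is recovered from the relative shape and CDM
(`|φ(F, y)| ≤ (μ + C) q^{δ(y)}`), and the trivial `|φ(F, y)| ≤ qⁿ` gives `|S| ≤ C q^{n − 1/2}`
(`Kowalski2007_thm14.linearPhase_le_pow`).

Typing: variables and parameters are indexed by finite types `ι`, `κ` (the paper's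
`{1, …, n}`, `{1, …, m}`); the finite field `F : Type` carries ANY compatible `L_ring`-structure
`[FirstOrder.Ring.CompatibleRing F]` (Mathlib's recommended hypothesis; all such structures
coincide, `compatibleRing_toStructure_eq`, so this is no extra generality, and
`definableCard_eq_card_of_mem_iff` links to the `compatibleRingOfRing` typing of
`definableCard` / the CDM fact); the definable set enters as any `A : Finset (ι → F)` with
`x ∈ A ↔ F ⊨ φ(x, y)` (the shape of the consumers' statements, e.g. route
`AlgebraicSTPPDichotomy` of summit `MatrixMultiplication`); `ψ : AddChar F ℂ`, `ψ ≠ 1`;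
`f : MvPolynomial ι ℤ` evaluated by `MvPolynomial.aeval x f`.

## Contents

* `Kowalski2007_thm14` — the NAMED FACT (D-0014).
* `Kowalski2007_thm14.linearPhase` — PROVED corollary, the LINEAR PHASE `ξ · x = ∑ᵢ xᵢ ξᵢ`
  uniformly in `ξ ∈ Fⁿ` (the form requested for `MatrixMultiplication`): Kowalski's phase is a
  fixed integer polynomial without parameters, so one adjoins new summation variables `u` pinned
  to new parameters by `u = ξ` (formula `φ(x, y) ∧ ⋀ᵢ uᵢ = ξᵢ`, phase `∑ Xᵢ Uᵢ ∈ ℤ[X, U]` of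
  degree `2`); the definable sets, level sets and sums correspond bijectively. (Kowalski's Thm. 3
  treats linear twists over `𝔽_p` by a different count of exceptional `ξ`.)
* `Kowalski2007_thm14.linearPhase_le_pow` — the same with the absolute bound `C |F|^{n − 1/2}`.
* `compatibleRing_toStructure_eq`, `realize_iff_of_compatibleRing`,
  `definableCard_eq_card_of_mem_iff` — all compatible ring structures on a ring agree; bridge to
  `definableCard`. [folklore]

## Not vendored (TODO(general form))

Multiplicative characters `χ(g(x))`, rational phases `f₁/f₂`, the decomposition into signed
`q`-Weil numbers itself (Thm. 14 (1), Thm. 12, Prop. 10–11), Cor. 13 (3) (definability of the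
strata `(δ, μ)`), Thm. 3 (linear twists: `≤ D p^{n−1}` exceptional `h`), Cor. 16. No discharge is
attempted: the proof rests on Deligne's Riemann hypothesis over finite fields (Weil II) and the
Grothendieck–Lefschetz trace formula, neither of which is in Mathlib.

## References

* E. Kowalski, *Exponential sums over definable subsets of finite fields*, Israel J. Math. 160
  (2007) 219–251: Thm. 2 (p. 6), §6 Thm. 12, Cor. 13, Thm. 14, Rem. 15, Cor. 16 (pp. 12–16 of
  arXiv:math/0504316). [Kowalski2007]
* Z. Chatzidakis, L. van den Dries, A. Macintyre, *Definable sets over finite fields*, J. reine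
  angew. Math. 427 (1992) 107–135. [ChatzidakisVanDenDriesMacintyre1992]
-/

noncomputable section

namespace Literature.ModelTheory.PseudofiniteFields

open FirstOrder FirstOrder.Language FirstOrder.Ring

/-! ### All compatible ring structures coincide; bridge to `definableCard` -/

/-- Any compatible `L_ring`-structure on `(R, +, ·, −, 0, 1)` IS the canonical one
`compatibleRingOfRing R`: the language of rings has exactly the five function symbols
`+, ·, −, 0, 1`, whose interpretations are prescribed by the `CompatibleRing` axioms, and no
relation symbols. [folklore] -/
theorem compatibleRing_toStructure_eq (R : Type*) [Add R] [Mul R] [Neg R] [One R] [Zero R]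
    (inst : CompatibleRing R) :
    inst.toStructure = (compatibleRingOfRing R).toStructure := by
  refine Language.Structure.ext ?_ ?_
  · funext n f x
    cases f with
    | add =>
      exact (@CompatibleRing.funMap_add R _ _ _ _ _ inst x).trans
        (@CompatibleRing.funMap_add R _ _ _ _ _ (compatibleRingOfRing R) x).symm
    | mul =>
      exact (@CompatibleRing.funMap_mul R _ _ _ _ _ inst x).trans
        (@CompatibleRing.funMap_mul R _ _ _ _ _ (compatibleRingOfRing R) x).symm
    | neg =>
      exact (@CompatibleRing.funMap_neg R _ _ _ _ _ inst x).trans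
        (@CompatibleRing.funMap_neg R _ _ _ _ _ (compatibleRingOfRing R) x).symm
    | zero =>
      exact (@CompatibleRing.funMap_zero R _ _ _ _ _ inst x).trans
        (@CompatibleRing.funMap_zero R _ _ _ _ _ (compatibleRingOfRing R) x).symm
    | one =>
      exact (@CompatibleRing.funMap_one R _ _ _ _ _ inst x).trans
        (@CompatibleRing.funMap_one R _ _ _ _ _ (compatibleRingOfRing R) x).symm
  · funext n r
    exact r.elim

/-- Realization of a ring formula does not depend on the choice of compatible ring structure
(there is only one, `compatibleRing_toStructure_eq`). [folklore] -/
theorem realize_iff_of_compatibleRing {R : Type*} [Add R] [Mul R] [Neg R] [One R] [Zero R]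
    [inst : CompatibleRing R] {α : Type*} (φ : Language.ring.Formula α) (v : α → R) :
    φ.Realize v ↔ (letI := compatibleRingOfRing R; φ.Realize v) := by
  rw [compatibleRing_toStructure_eq R inst]

/-- Bridge to the point count `definableCard` of `DefinableSetsFiniteFields.lean` (typed with
`compatibleRingOfRing`): if a `Finset` `A` is the definable set `φ(K^m; c)` for SOME compatible
ring structure on the finite ring `K`, then `definableCard K φ c = |A|`. [folklore] -/
theorem definableCard_eq_card_of_mem_iff (K : Type*) [Add K] [Mul K] [Neg K] [One K] [Zero K]
    [Fintype K] [CompatibleRing K] {m n : ℕ} (φ : Language.ring.Formula (Fin m ⊕ Fin n))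
    (c : Fin n → K) (A : Finset (Fin m → K)) (hA : ∀ x, x ∈ A ↔ φ.Realize (Sum.elim x c)) :
    definableCard K φ c = A.card := by
  classical
  rw [definableCard_eq_card_filter]
  congr 1
  ext x
  rw [Finset.mem_filter, hA x, realize_iff_of_compatibleRing]
  simp

/-! ### The named fact -/

/-- **Kowalski 2007, Theorem 14 (1)–(2)** (with Cor. 13 (1)–(2); the shape of his Thm. 2), special
case of pure additive character sums of an integer polynomial phase. For every formula `φ(x, y)`
of the language of rings (variables `x` indexed by a finite type `ι`, parameters `y` by a finite
type `κ`) and every `f ∈ ℤ[Xᵢ : i ∈ ι]` there are constants `C ≥ 0`, `η > 0` and `p₀`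
(depending only on `φ` and `f`) such that for every finite field `F` of characteristic `≥ p₀`
(Rem. 15 (1): large CHARACTERISTIC is necessary), every `y ∈ F^κ`, with `A = φ(F, y) =
{x ∈ F^ι | F ⊨ φ(x, y)}`, and every NON-TRIVIAL additive character `ψ` of `F`:
EITHER some level set is large, `|{x ∈ A : f(x) = c}| ≥ η |A|` for some `c ∈ F`,
OR there is square-root cancellation, `|∑_{x ∈ A} ψ(f(x))| ≤ C |F|^{−1/2} |A|`.
(Printed: (1) `S = ` a signed sum of `≤ K e B₂` signed `q`-Weil numbers of weights `≤ 2δ(y)` for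
`q` large, so `|S| ≤ 3KB₂ q^{δ(y) − γ(y)/2}`; (2) for `p` large, `γ(y) > 0` — hence `≥ 1` —
unless `ψ` is trivial or a level set of `f` has `≥ η |φ(𝔽_q, y)|` points; `δ(y)` as in Cor. 13,
`|φ(𝔽_q, y)| = μ(y) q^{δ(y)} + O(q^{δ(y) − 1/2})`, `μ(y) > 0`, finitely many `(δ, μ)`; the
relative shape follows as in the proof of Thm. 2 / Cor. 16 — see the module docstring.) The
compatible ring structure on `F` is arbitrary (they all coincide, `compatibleRing_toStructure_eq`).
[cite: Kowalski2007, Thm. 14 (1)–(2) with Cor. 13 (1)–(2) and Thm. 2 (arXiv pp. 6, 14–16)] -/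
def Kowalski2007_thm14 : Prop :=
  ∀ (ι κ : Type) [Finite ι] [Finite κ] (φ : Language.ring.Formula (ι ⊕ κ))
    (f : MvPolynomial ι ℤ),
    ∃ (C η : ℝ) (p₀ : ℕ), 0 ≤ C ∧ 0 < η ∧
      ∀ (F : Type) [Field F] [Fintype F] [DecidableEq F] [CompatibleRing F],
        p₀ ≤ ringChar F →
          ∀ (y : κ → F) (A : Finset (ι → F)),
            (∀ x, x ∈ A ↔ φ.Realize (Sum.elim x y)) →
              ∀ ψ : AddChar F ℂ, ψ ≠ 1 →
                (∃ c : F, η * (A.card : ℝ) ≤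
                    ((A.filter fun x => MvPolynomial.aeval x f = c).card : ℝ)) ∨
                  ‖∑ x ∈ A, ψ (MvPolynomial.aeval x f)‖ ≤
                    C * (Fintype.card F : ℝ) ^ (-(1 / 2 : ℝ)) * (A.card : ℝ)

-- TODO(general form): Kowalski's Thm. 14 allows a multiplicative character `χ(g(x))`,
-- `g = g₁/g₂`, and a rational phase `f = f₁/f₂` (summing over `f₂ g₂ ≠ 0`), and states the
-- decomposition of `S` into signed `q`-Weil numbers of weights `≤ 2δ(y)`; only the additive,
-- polynomial-phase estimate is vendored here.

/-! ### The linear phase `ξ · x` (proved corollary) -/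

section LinearPhase

variable {ι κ : Type}

/-- The reparametrised formula `φ(x, y) ∧ ⋀ᵢ uᵢ = ξᵢ` in the variables `(x, u) ∈ F^ι × F^ι` and
the parameters `(y, ξ) ∈ F^κ × F^ι`. [folklore] -/
def linearPhaseFormula [Finite ι] (φ : Language.ring.Formula (ι ⊕ κ)) :
    Language.ring.Formula ((ι ⊕ ι) ⊕ (κ ⊕ ι)) :=
  φ.relabel (Sum.map Sum.inl Sum.inl) ⊓
    Formula.iInf fun i : ι =>
      Term.equal (Term.var (Sum.inl (Sum.inr i))) (Term.var (Sum.inr (Sum.inr i)))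

/-- The fixed integer phase `∑ᵢ Xᵢ Uᵢ ∈ ℤ[X, U]` (degree `2`, no parameters). [folklore] -/
def linearPhasePoly [Fintype ι] : MvPolynomial (ι ⊕ ι) ℤ :=
  ∑ i : ι, MvPolynomial.X (Sum.inl i) * MvPolynomial.X (Sum.inr i)

/-- `(∑ᵢ Xᵢ Uᵢ)(x, ξ) = ∑ᵢ xᵢ ξᵢ`. [folklore] -/
theorem aeval_linearPhasePoly [Fintype ι] {F : Type} [CommRing F] (x ξ : ι → F) :
    MvPolynomial.aeval (Sum.elim x ξ) (linearPhasePoly (ι := ι)) = ∑ i, x i * ξ i := by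
  simp [linearPhasePoly, map_sum]

/-- The points of the reparametrised definable set over `(y, ξ)` are exactly the `(x, ξ)` with
`x ∈ φ(F, y)`. [folklore] -/
theorem realize_linearPhaseFormula_iff [Finite ι] {F : Type} [Field F] [CompatibleRing F]
    (φ : Language.ring.Formula (ι ⊕ κ)) (y : κ → F) (ξ : ι → F) (z : ι ⊕ ι → F) :
    (linearPhaseFormula φ).Realize (Sum.elim z (Sum.elim y ξ)) ↔
      φ.Realize (Sum.elim (z ∘ Sum.inl) y) ∧ z ∘ Sum.inr = ξ := by
  have hcomp : Sum.elim z (Sum.elim y ξ) ∘ Sum.map Sum.inl Sum.inl = Sum.elim (z ∘ Sum.inl) y := by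
    ext (i | j) <;> simp
  simp only [linearPhaseFormula, Formula.realize_inf, Formula.realize_relabel, hcomp,
    Formula.realize_iInf, Formula.realize_equal, Term.realize_var, Sum.elim_inl, Sum.elim_inr]
  exact and_congr_right fun _ => funext_iff.symm

/-- **Linear-phase corollary of Kowalski 2007 Thm. 14** (the form used on `MatrixMultiplication`):
for every ring formula `φ(x, y)` there are `C ≥ 0`, `η > 0`, `p₀` such that for every finite
field `F` of characteristic `≥ p₀`, every `y`, every `ξ ∈ F^ι`, with `A = φ(F, y)`, and every
non-trivial additive character `ψ`: some hyperplane level set `{x ∈ A : ∑ᵢ xᵢ ξᵢ = c}` has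
`≥ η |A|` points, or `|∑_{x ∈ A} ψ(∑ᵢ xᵢ ξᵢ)| ≤ C |F|^{−1/2} |A|` — uniformly in `ξ`, because
the fact is applied to the single formula `φ(x, y) ∧ ⋀ᵢ uᵢ = ξᵢ` (`linearPhaseFormula`) and the
single parameter-free phase `∑ᵢ Xᵢ Uᵢ` (`linearPhasePoly`), under the bijection `x ↦ (x, ξ)`.
[cite: Kowalski2007, Thm. 14 (1)–(2) (via the reparametrisation u = ξ)] -/
theorem Kowalski2007_thm14.linearPhase (h : Kowalski2007_thm14) (ι κ : Type) [Fintype ι]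
    [Finite κ] (φ : Language.ring.Formula (ι ⊕ κ)) :
    ∃ (C η : ℝ) (p₀ : ℕ), 0 ≤ C ∧ 0 < η ∧
      ∀ (F : Type) [Field F] [Fintype F] [DecidableEq F] [CompatibleRing F],
        p₀ ≤ ringChar F →
          ∀ (y : κ → F) (ξ : ι → F) (A : Finset (ι → F)),
            (∀ x, x ∈ A ↔ φ.Realize (Sum.elim x y)) →
              ∀ ψ : AddChar F ℂ, ψ ≠ 1 →
                (∃ c : F, η * (A.card : ℝ) ≤
                    ((A.filter fun x => ∑ i, x i * ξ i = c).card : ℝ)) ∨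
                  ‖∑ x ∈ A, ψ (∑ i, x i * ξ i)‖ ≤
                    C * (Fintype.card F : ℝ) ^ (-(1 / 2 : ℝ)) * (A.card : ℝ) := by
  obtain ⟨C, η, p₀, hC, hη, hmain⟩ := h (ι ⊕ ι) (κ ⊕ ι) (linearPhaseFormula φ) linearPhasePoly
  refine ⟨C, η, p₀, hC, hη, fun F _ _ _ _ hp y ξ A hA ψ hψ => ?_⟩
  -- embed `x ↦ (x, ξ)`
  let e : (ι → F) ↪ (ι ⊕ ι → F) :=
    ⟨fun x => Sum.elim x ξ, fun x x' hx => by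
      have := congrArg (fun z : ι ⊕ ι → F => z ∘ Sum.inl) hx
      simpa using this⟩
  have he : ∀ x, e x = Sum.elim x ξ := fun _ => rfl
  have hA' : ∀ z, z ∈ A.map e ↔ (linearPhaseFormula φ).Realize (Sum.elim z (Sum.elim y ξ)) := by
    intro z
    rw [realize_linearPhaseFormula_iff, Finset.mem_map]
    constructor
    · rintro ⟨x, hx, rfl⟩
      exact ⟨by simpa [he] using (hA x).1 hx, by simp [he]⟩
    · rintro ⟨hφ, hξ⟩
      refine ⟨z ∘ Sum.inl, (hA _).2 hφ, ?_⟩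
      rw [he, ← hξ]
      ext (i | i) <;> rfl
  have key := hmain F hp (Sum.elim y ξ) (A.map e) hA' ψ hψ
  rw [Finset.card_map, Finset.sum_map] at key
  simp only [he, aeval_linearPhasePoly] at key
  rcases key with ⟨c, hc⟩ | hS
  · refine Or.inl ⟨c, hc.trans_eq ?_⟩
    rw [Finset.filter_map, Finset.card_map]
    congr 2
    exact Finset.filter_congr fun x _ => by simp [he, aeval_linearPhasePoly]
  · exact Or.inr hS

/-- The linear-phase dichotomy with the ABSOLUTE bound `C |F|^{n − 1/2}`, `n = |ι|` (from the
trivial `|φ(F, y)| ≤ |F|ⁿ`; the printed bound is `C q^{δ(y) − 1/2}` with `δ(y) ≤ n` the CDM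
dimension). [cite: Kowalski2007, Thm. 14 (1)–(2), weakened by δ(y) ≤ n (Cor. 13 (2))] -/
theorem Kowalski2007_thm14.linearPhase_le_pow (h : Kowalski2007_thm14) (ι κ : Type) [Fintype ι]
    [DecidableEq ι] [Finite κ] (φ : Language.ring.Formula (ι ⊕ κ)) :
    ∃ (C η : ℝ) (p₀ : ℕ), 0 ≤ C ∧ 0 < η ∧
      ∀ (F : Type) [Field F] [Fintype F] [DecidableEq F] [CompatibleRing F],
        p₀ ≤ ringChar F →
          ∀ (y : κ → F) (ξ : ι → F) (A : Finset (ι → F)),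
            (∀ x, x ∈ A ↔ φ.Realize (Sum.elim x y)) →
              ∀ ψ : AddChar F ℂ, ψ ≠ 1 →
                (∃ c : F, η * (A.card : ℝ) ≤
                    ((A.filter fun x => ∑ i, x i * ξ i = c).card : ℝ)) ∨
                  ‖∑ x ∈ A, ψ (∑ i, x i * ξ i)‖ ≤
                    C * (Fintype.card F : ℝ) ^ ((Fintype.card ι : ℝ) - 1 / 2) := by
  obtain ⟨C, η, p₀, hC, hη, hmain⟩ := h.linearPhase ι κ φ
  refine ⟨C, η, p₀, hC, hη, fun F _ _ _ _ hp y ξ A hA ψ hψ => ?_⟩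
  rcases hmain F hp y ξ A hA ψ hψ with hlevel | hS
  · exact Or.inl hlevel
  · refine Or.inr (hS.trans ?_)
    have hq : (0 : ℝ) < (Fintype.card F : ℝ) := by exact_mod_cast Fintype.card_pos
    have hAle : (A.card : ℝ) ≤ (Fintype.card F : ℝ) ^ (Fintype.card ι : ℝ) := by
      rw [Real.rpow_natCast]
      exact_mod_cast (Finset.card_le_univ A).trans_eq (by rw [Fintype.card_fun])
    calc C * (Fintype.card F : ℝ) ^ (-(1 / 2 : ℝ)) * (A.card : ℝ)
        ≤ C * (Fintype.card F : ℝ) ^ (-(1 / 2 : ℝ)) * (Fintype.card F : ℝ) ^ (Fintype.card ι : ℝ) :=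
          mul_le_mul_of_nonneg_left hAle (by positivity)
      _ = C * (Fintype.card F : ℝ) ^ ((Fintype.card ι : ℝ) - 1 / 2) := by
          rw [mul_assoc, ← Real.rpow_add hq]
          ring_nf

end LinearPhase

end Literature.ModelTheory.PseudofiniteFields

end
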